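import Literature.Computability.Cryptography.RegevBDDIntegerNoise
import Literature.Algebra.EuclideanLattices.DiscreteGaussianInt
import Literature.Computability.Cryptography.StatisticalDistanceProofs
import HarnessLib

/-!
# The integer noise `⌊L·e⌋` of Regev's reduction is statistically close to a wide discrete Gaussian on `ℤ`

Topic `Computability/Cryptography` (family `pqc`), grouping namespace `Regev2009`; sequel of
`RegevBDDIntegerNoise.lean` (`floorGaussian L α₀ : PMF ℤ`, the law of `⌊L·e⌋` for `e ∼ N(0, α₀²/(2π))`, through
which the manufactured `LWE` sample of Lemma 3.11 is an exact integer function of its draws,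
`bddLWESampleOf_eq_bind_floorGaussian`) and of `Algebra/EuclideanLattices/DiscreteGaussianInt.lean`
(`discreteGaussianInt S c = D_{ℤ,S,c}`). Everything here is PROVED; no definition, no named fact.

A machine cannot draw `⌊L·e⌋` (cell probabilities are Gaussian integrals) but it can draw — by rejection,
`Probability/Distributions/GaussianRejectionSampler.lean` — from the discrete Gaussian `D_{ℤ,S,0}` with the
RATIONAL width code `θ = π/S²`, `S = L·α₀` (`α₀² ∈ π·ℚ` in the consumer). This file shows that this is
good enough: **`tvDist_discreteGaussianInt_floorGaussian_le`**,

  `Δ(D_{ℤ,Lα₀,0}, floorGaussian L α₀) ≤ 2/(L·α₀)`,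

with no smoothing hypothesis at all. Writing `ρ = ρ_S`, `I_j = Pr[⌊L·e⌋ = j] = ∫_j^{j+1} ρ(t)/S dt`
(`toReal_floorGaussian_apply`, the rescaled density is `ρ_S/S`, `gaussianPDFReal_eq`) and
`Z = ρ(ℤ)`: `ρ` is monotone on every cell `[j, j+1]`, so `|ρ(j) - S·I_j| ≤ |ρ(j) - ρ(j+1)|`
(`abs_sub_mul_floorGaussian_le`), and these oscillations telescope to `2ρ(0) = 2` over `ℤ` (`hasSum_osc`);
with `∑ I_j = 1` this gives both `|S - Z| ≤ 2` and `∑_j |ρ(j)/Z - I_j| ≤ |S - Z|/S + 2/S ≤ 4/S`.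

## References

* O. Regev, *On lattices, learning with errors, random linear codes, and cryptography*, J. ACM 56 (2009),
  art. 34, Lemma 3.11 (proof: the noise `e`) and §2 (rounded Gaussians) [RegevLWE2009].
* C. Peikert, *Public-key cryptosystems from the worst-case shortest vector problem*, STOC 2009, full version
  p. 7 ("we can efficiently sample … to within a suitable amount of precision") [Peikert2009].
-/

noncomputable section

open MeasureTheory ProbabilityTheory Set Filter
open scoped Real ENNReal NNReal Topology

namespace Literature.Computability.Cryptography

namespace Regev2009

open Literature.Algebra.EuclideanLattices

/-! ### The cell probabilities of `⌊L·e⌋` -/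

/-- The variance of `L·e`: `(Lα₀)²/(2π)`. [folklore] -/
theorem toNNReal_var_mul (L : ℕ) (α₀ : ℝ) :
    NNReal.mk ((L : ℝ) ^ 2) (sq_nonneg _) * Real.toNNReal (α₀ ^ 2 / (2 * π)) = Real.toNNReal ((L * α₀) ^ 2 / (2 * π)) := by
  have h0 : 0 ≤ α₀ ^ 2 / (2 * π) := by positivity
  rw [← NNReal.coe_inj, NNReal.coe_mul, NNReal.coe_mk, Real.coe_toNNReal _ h0,
    Real.coe_toNNReal _ (by positivity)]
  ring

/-- **`Pr[⌊L·e⌋ = j] = N(0, (Lα₀)²/(2π))([j, j+1))`**: rescale `e ↦ L·e` (`gaussianReal_map_const_mul`) and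
read the floor's fibre `[j, j+1)`. [cite: RegevLWE2009, Lemma 3.11 (proof)] -/
theorem floorGaussian_apply (L : ℕ) (α₀ : ℝ) (j : ℤ) :
    floorGaussian L α₀ j = gaussianReal 0 (Real.toNNReal ((L * α₀) ^ 2 / (2 * π))) (Ico (j : ℝ) ((j : ℝ) + 1)) := by
  unfold floorGaussian
  rw [Measure.toPMF_apply]
  have hcomp : (fun e : ℝ => ⌊(L : ℝ) * e⌋) = Int.floor ∘ fun e : ℝ => (L : ℝ) * e := rfl
  rw [hcomp, ← Measure.map_map Int.measurable_floor (measurable_const_mul _), gaussianReal_map_const_mul,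
    mul_zero, toNNReal_var_mul, Measure.map_apply Int.measurable_floor (measurableSet_singleton j),
    Int.preimage_floor_singleton]

/-- The cell probability as an integral of the density: `Pr[⌊L·e⌋ = j] = ∫_{[j,j+1)} gaussianPDFReal`
(`0 < Lα₀`). [folklore] -/
theorem toReal_floorGaussian_apply (L : ℕ) {α₀ : ℝ} (hS : 0 < L * α₀) (j : ℤ) :
    (floorGaussian L α₀ j).toReal =
      ∫ x in Ico (j : ℝ) ((j : ℝ) + 1), gaussianPDFReal 0 (Real.toNNReal ((L * α₀) ^ 2 / (2 * π))) x := by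
  have hv : Real.toNNReal ((L * α₀) ^ 2 / (2 * π)) ≠ 0 := by
    rw [ne_eq, Real.toNNReal_eq_zero, not_le]; positivity
  rw [floorGaussian_apply, gaussianReal_apply_eq_integral 0 hv, ENNReal.toReal_ofReal]
  exact setIntegral_nonneg measurableSet_Ico fun x _ => gaussianPDFReal_nonneg _ _ _

/-- **The rescaled density is `ρ_S/S`**: `gaussianPDFReal 0 ((S²/(2π))) x = e^{-πx²/S²}/S` for `S > 0`.
[cite: RegevLWE2009, §2 (the normal density of parameter `S`)] -/
theorem gaussianPDFReal_eq {S : ℝ} (hS : 0 < S) (x : ℝ) :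
    gaussianPDFReal 0 (Real.toNNReal (S ^ 2 / (2 * π))) x = gaussianFunction S x / S := by
  rw [gaussianPDFReal_def]
  simp only [sub_zero]
  rw [Real.coe_toNNReal _ (by positivity), gaussianFunction, Real.norm_eq_abs, sq_abs]
  have h1 : Real.sqrt (2 * π * (S ^ 2 / (2 * π))) = S := by
    rw [show 2 * π * (S ^ 2 / (2 * π)) = S ^ 2 by field_simp, Real.sqrt_sq hS.le]
  rw [h1]
  have h2 : -x ^ 2 / (2 * (S ^ 2 / (2 * π))) = -π * x ^ 2 / S ^ 2 := by field_simp
  rw [h2]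
  ring

/-! ### Monotone cells: `|ρ(j) - S·I_j| ≤ |ρ(j) - ρ(j+1)|` -/

/-- `ρ_S` is even and decreasing in `|x|`: `|x| ≤ |y| → ρ_S(y) ≤ ρ_S(x)`. [folklore] -/
theorem gaussianFunction_anti {S : ℝ} (hS : 0 < S) {x y : ℝ} (h : |x| ≤ |y|) : gaussianFunction S y ≤ gaussianFunction S x := by
  unfold gaussianFunction
  refine Real.exp_le_exp.2 ?_
  rw [Real.norm_eq_abs, Real.norm_eq_abs]
  have hS2 : 0 < S ^ 2 := pow_pos hS 2
  have hxy : |x| ^ 2 ≤ |y| ^ 2 := pow_le_pow_left₀ (abs_nonneg x) h 2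
  rw [div_le_div_iff_of_pos_right hS2]
  nlinarith [Real.pi_pos]

/-- **One cell**: with `I_j = Pr[⌊L·e⌋ = j]`, `S = Lα₀ > 0` and `ρ = ρ_S`: `|ρ(j) - S·I_j| ≤ |ρ(j) - ρ(j+1)|`
(on `[j, j+1]` the density `ρ/S` is monotone, so `S·I_j` lies between `ρ(j)` and `ρ(j+1)`).
[cite: RegevLWE2009, §2 (rounding a normal variable)] -/
theorem abs_sub_mul_floorGaussian_le (L : ℕ) {α₀ : ℝ} (hS : 0 < L * α₀) (j : ℤ) :
    |gaussianFunction (L * α₀) (j : ℝ) - (L * α₀) * (floorGaussian L α₀ j).toReal| ≤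
      |gaussianFunction (L * α₀) (j : ℝ) - gaussianFunction (L * α₀) ((j : ℝ) + 1)| := by
  set S : ℝ := L * α₀ with hSdef
  set ρ : ℝ → ℝ := gaussianFunction S with hρ
  have hI := toReal_floorGaussian_apply L hS j
  rw [← hSdef] at hI
  -- the integral between the endpoint values, in either order
  have hint : ∀ {lo hi : ℝ}, (∀ x ∈ Ico (j : ℝ) ((j : ℝ) + 1), lo ≤ ρ x ∧ ρ x ≤ hi) →
      lo ≤ S * (floorGaussian L α₀ j).toReal ∧ S * (floorGaussian L α₀ j).toReal ≤ hi := by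
    intro lo hi hb
    have hpdf : ∀ x, gaussianPDFReal 0 (Real.toNNReal (S ^ 2 / (2 * π))) x = ρ x / S := fun x => gaussianPDFReal_eq hS x
    have hmeas : volume (Ico (j : ℝ) ((j : ℝ) + 1)) = 1 := by rw [Real.volume_Ico]; simp
    have hfin : volume (Ico (j : ℝ) ((j : ℝ) + 1)) ≠ ∞ := by rw [hmeas]; exact ENNReal.one_ne_top
    have hpdf' : gaussianPDFReal 0 (Real.toNNReal (S ^ 2 / (2 * π))) = fun x => ρ x / S := funext hpdf
    have hintf : IntegrableOn (fun x => ρ x / S) (Ico (j : ℝ) ((j : ℝ) + 1)) := by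
      have := (integrable_gaussianPDFReal 0 (Real.toNNReal (S ^ 2 / (2 * π)))).integrableOn (s := Ico (j : ℝ) ((j : ℝ) + 1))
      rw [hpdf'] at this
      exact this
    have hval : S * (floorGaussian L α₀ j).toReal = ∫ x in Ico (j : ℝ) ((j : ℝ) + 1), ρ x := by
      rw [hI]
      simp_rw [hpdf]
      rw [integral_div, mul_div_cancel₀ _ hS.ne']
    have hintρ : IntegrableOn ρ (Ico (j : ℝ) ((j : ℝ) + 1)) := by
      have h2 := hintf.mul_const S
      simp only [div_mul_cancel₀ _ hS.ne'] at h2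
      exact h2
    rw [hval]
    constructor
    · have h := setIntegral_mono_on (integrableOn_const hfin) hintρ measurableSet_Ico fun x hx => (hb x hx).1
      rwa [setIntegral_const, Measure.real, hmeas, ENNReal.toReal_one, one_smul] at h
    · have h := setIntegral_mono_on hintρ (integrableOn_const hfin) measurableSet_Ico fun x hx => (hb x hx).2
      rwa [setIntegral_const, Measure.real, hmeas, ENNReal.toReal_one, one_smul] at h
  rcases le_or_gt 0 j with hj | hj
  · -- `0 ≤ j`: `ρ(j+1) ≤ ρ(x) ≤ ρ(j)` on the cell
    have hb : ∀ x ∈ Ico (j : ℝ) ((j : ℝ) + 1), ρ ((j : ℝ) + 1) ≤ ρ x ∧ ρ x ≤ ρ (j : ℝ) := by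
      intro x hx
      have hj' : (0 : ℝ) ≤ j := by exact_mod_cast hj
      refine ⟨gaussianFunction_anti hS ?_, gaussianFunction_anti hS ?_⟩
      · rw [abs_of_nonneg (by linarith [hx.1]), abs_of_nonneg (by linarith)]; exact hx.2.le
      · rw [abs_of_nonneg hj', abs_of_nonneg (by linarith [hx.1])]; exact hx.1
    obtain ⟨h1, h2⟩ := hint hb
    rw [abs_of_nonneg (by linarith), abs_of_nonneg (by linarith)]
    linarith
  · -- `j ≤ -1`: `ρ(j) ≤ ρ(x) ≤ ρ(j+1)` on the cell
    have hb : ∀ x ∈ Ico (j : ℝ) ((j : ℝ) + 1), ρ (j : ℝ) ≤ ρ x ∧ ρ x ≤ ρ ((j : ℝ) + 1) := by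
      intro x hx
      have hj' : (j : ℝ) + 1 ≤ 0 := by
        have : j + 1 ≤ 0 := by omega
        exact_mod_cast this
      refine ⟨gaussianFunction_anti hS ?_, gaussianFunction_anti hS ?_⟩
      · rw [abs_of_nonpos (by linarith [hx.2]), abs_of_nonpos (by linarith)]; linarith [hx.1]
      · rw [abs_of_nonpos hj', abs_of_nonpos (by linarith [hx.2])]; linarith [hx.2]
    obtain ⟨h1, h2⟩ := hint hb
    rw [abs_of_nonpos (by linarith), abs_of_nonpos (by linarith)]
    linarith

/-! ### The oscillations telescope to `2` -/

/-- `ρ_S(n) → 0`. [folklore] -/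
theorem tendsto_gaussianFunction_natCast {S : ℝ} (hS : 0 < S) :
    Tendsto (fun n : ℕ => gaussianFunction S (n : ℝ)) atTop (𝓝 0) := by
  unfold gaussianFunction
  simp only [Real.norm_eq_abs, sq_abs]
  refine Real.tendsto_exp_atBot.comp ?_
  have h1 : Tendsto (fun n : ℕ => ((n : ℝ)) ^ 2) atTop atTop :=
    (tendsto_pow_atTop two_ne_zero).comp tendsto_natCast_atTop_atTop
  have h2 : Tendsto (fun n : ℕ => -π / S ^ 2 * (n : ℝ) ^ 2) atTop atBot :=
    h1.const_mul_atTop_of_neg (by have := Real.pi_pos; have := pow_pos hS 2; exact div_neg_of_neg_of_pos (by linarith) this)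
  refine h2.congr fun n => ?_
  ring

/-- The telescoping series `∑_{n ≥ 0} (ρ(n) - ρ(n+1)) = ρ(0) = 1`. [folklore] -/
theorem hasSum_sub_succ {S : ℝ} (hS : 0 < S) :
    HasSum (fun n : ℕ => gaussianFunction S (n : ℝ) - gaussianFunction S ((n : ℝ) + 1)) 1 := by
  have h0 : gaussianFunction S ((0 : ℕ) : ℝ) = 1 := by simp [gaussianFunction]
  have hlim := tendsto_gaussianFunction_natCast hS
  have h := hlim.const_sub (gaussianFunction S ((0 : ℕ) : ℝ))
  rw [sub_zero, h0] at h
  -- partial sums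
  have hpartial : ∀ N : ℕ, ∑ n ∈ Finset.range N, (gaussianFunction S (n : ℝ) - gaussianFunction S ((n : ℝ) + 1)) =
      1 - gaussianFunction S (N : ℝ) := by
    intro N
    induction N with
    | zero => simp [gaussianFunction]
    | succ N ih => rw [Finset.sum_range_succ, ih]; push_cast; ring
  have hnonneg : ∀ n : ℕ, 0 ≤ gaussianFunction S (n : ℝ) - gaussianFunction S ((n : ℝ) + 1) := fun n => by
    have := gaussianFunction_anti hS (x := (n : ℝ)) (y := (n : ℝ) + 1)
      (by rw [abs_of_nonneg (Nat.cast_nonneg n), abs_of_nonneg (by positivity)]; linarith)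
    linarith
  have hsum : Summable fun n : ℕ => gaussianFunction S (n : ℝ) - gaussianFunction S ((n : ℝ) + 1) := by
    refine summable_of_sum_range_le hnonneg (c := 1) fun N => ?_
    rw [hpartial]
    linarith [gaussianFunction_pos S (N : ℝ)]
  have htend' : Tendsto (fun N : ℕ => ∑ n ∈ Finset.range N, (gaussianFunction S (n : ℝ) - gaussianFunction S ((n : ℝ) + 1)))
      atTop (𝓝 1) := by
    simp_rw [hpartial]
    exact h
  have heq : ∑' n : ℕ, (gaussianFunction S (n : ℝ) - gaussianFunction S ((n : ℝ) + 1)) = 1 :=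
    tendsto_nhds_unique hsum.hasSum.tendsto_sum_nat htend'
  convert hsum.hasSum using 1
  exact heq.symm

/-- **The oscillations over all cells sum to `2`**: `∑_{j ∈ ℤ} |ρ(j) - ρ(j+1)| = 2ρ(0) = 2` (telescoping on
each side of `0`, `ρ` even). [folklore] -/
theorem hasSum_osc {S : ℝ} (hS : 0 < S) :
    HasSum (fun j : ℤ => |gaussianFunction S (j : ℝ) - gaussianFunction S ((j : ℝ) + 1)|) 2 := by
  have hnat := hasSum_sub_succ hS
  have hnonneg : ∀ n : ℕ, 0 ≤ gaussianFunction S (n : ℝ) - gaussianFunction S ((n : ℝ) + 1) := fun n => by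
    have := gaussianFunction_anti hS (x := (n : ℝ)) (y := (n : ℝ) + 1)
      (by rw [abs_of_nonneg (Nat.cast_nonneg n), abs_of_nonneg (by positivity)]; linarith)
    linarith
  rw [show (2 : ℝ) = 1 + 1 by norm_num]
  refine HasSum.of_nat_of_neg_add_one ?_ ?_
  · convert hnat using 1
    funext n
    rw [Int.cast_natCast, abs_of_nonneg (hnonneg n)]
  · convert hnat using 1
    funext n
    have h1 : (((-(n + 1 : ℤ)) : ℤ) : ℝ) = -((n : ℝ) + 1) := by push_cast; ring
    rw [h1, show -((n : ℝ) + 1) + 1 = -(n : ℝ) by ring, gaussianFunction_neg, gaussianFunction_neg,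
      abs_sub_comm, abs_of_nonneg (hnonneg n)]

/-- The Gaussian weights on `ℤ` are summable with sum `Z = ρ_S(ℤ)`. [folklore] -/
theorem hasSum_gaussianFunction_intCast {S : ℝ} (hS : 0 < S) :
    HasSum (fun j : ℤ => gaussianFunction S (j : ℝ)) (gaussianMassInt S 0).toReal := by
  have hne := gaussianMassInt_ne_top hS.ne' (0 : ℝ)
  unfold gaussianMassInt at hne ⊢
  have hsum := ENNReal.summable_toReal hne
  have hfun : (fun k : ℤ => (ENNReal.ofReal (gaussianFunction S ((k : ℝ) - 0))).toReal) = fun j : ℤ => gaussianFunction S (j : ℝ) := by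
    funext k
    rw [ENNReal.toReal_ofReal (gaussianFunction_pos _ _).le, sub_zero]
  rw [hfun] at hsum
  rw [ENNReal.tsum_toReal_eq (fun _ => ENNReal.ofReal_ne_top), hfun]
  exact hsum.hasSum

/-- **`Δ(D_{ℤ,Lα₀,0}, floorGaussian L α₀) ≤ 2/(Lα₀)`.** With `I_j = Pr[⌊L·e⌋ = j]`, `ρ = ρ_S`, `S = Lα₀`,
`Z = ρ(ℤ)`: `∑_j |ρ(j)/Z - I_j| ≤ |S - Z|/S + (∑_j |ρ(j) - S·I_j|)/S ≤ 2·2/S`, because the cell defects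
`|ρ(j) - S·I_j|` are dominated by the oscillations (`abs_sub_mul_floorGaussian_le`, `hasSum_osc`) and
`S - Z = ∑_j (S·I_j - ρ(j))` (`∑ I_j = 1`). [cite: RegevLWE2009, Lemma 3.11 (proof) with §2; Peikert2009, full version p. 7] -/
theorem tvDist_discreteGaussianInt_floorGaussian_le (L : ℕ) {α₀ : ℝ} (hS : 0 < L * α₀) :
    (discreteGaussianInt (L * α₀) 0).tvDist (floorGaussian L α₀) ≤ 2 / (L * α₀) := by
  set S : ℝ := L * α₀ with hSdef
  set ρ : ℤ → ℝ := fun j => gaussianFunction S (j : ℝ) with hρ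
  set I : ℤ → ℝ := fun j => (floorGaussian L α₀ j).toReal with hIdef
  set Z : ℝ := (gaussianMassInt S 0).toReal with hZ
  have hρZ : HasSum ρ Z := hasSum_gaussianFunction_intCast hS
  have hZ0 : 0 < Z := by
    calc (0 : ℝ) < ρ 0 := gaussianFunction_pos S _
      _ = ∑ j ∈ ({0} : Finset ℤ), ρ j := by simp
      _ ≤ Z := sum_le_hasSum _ (fun j _ => (gaussianFunction_pos S _).le) hρZ
  have hI : HasSum I 1 := by
    have h := (PMF.summable_coe_toReal (floorGaussian L α₀)).hasSum
    rwa [PMF.tsum_coe_toReal] at h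
  have hD : ∀ j, (discreteGaussianInt S 0 j).toReal = ρ j / Z := by
    intro j
    rw [discreteGaussianInt_apply hS, ENNReal.toReal_mul, ENNReal.toReal_inv,
      ENNReal.toReal_ofReal (gaussianFunction_pos _ _).le, sub_zero, div_eq_mul_inv]
  -- the cell defects
  set g : ℤ → ℝ := fun j => |ρ j - S * I j| with hg
  have hcell : ∀ j, g j ≤ |gaussianFunction S (j : ℝ) - gaussianFunction S ((j : ℝ) + 1)| :=
    fun j => abs_sub_mul_floorGaussian_le L hS j
  have hosc := hasSum_osc hS
  have hgsum : Summable g := Summable.of_nonneg_of_le (fun j => abs_nonneg _) hcell hosc.summable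
  set A : ℝ := ∑' j, g j with hA
  have hA2 : A ≤ 2 := hasSum_le hcell hgsum.hasSum hosc
  have hA0 : 0 ≤ A := tsum_nonneg fun j => abs_nonneg _
  -- `|S - Z| ≤ A`
  have hsub : HasSum (fun j => S * I j - ρ j) (S * 1 - Z) := (hI.mul_left S).sub hρZ
  have hSZ : |S - Z| ≤ A := by
    rw [abs_le]
    constructor
    · have h := hasSum_le (fun j => show -g j ≤ S * I j - ρ j from by
        have := neg_abs_le (S * I j - ρ j); rw [abs_sub_comm] at this; exact this) hgsum.hasSum.neg hsub
      linarith
    · have h := hasSum_le (fun j => show S * I j - ρ j ≤ g j from by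
        have := le_abs_self (S * I j - ρ j); rw [abs_sub_comm] at this; exact this) hsub hgsum.hasSum
      linarith
  -- pointwise: `|ρ/Z - I| ≤ ρ·|1/Z - 1/S| + g/S`
  have hpt : ∀ j, |(discreteGaussianInt S 0 j).toReal - I j| ≤ ρ j * |1 / Z - 1 / S| + g j / S := by
    intro j
    rw [hD]
    have hsplit : ρ j / Z - I j = ρ j * (1 / Z - 1 / S) + (ρ j - S * I j) / S := by field_simp; ring
    rw [hsplit]
    refine (abs_add_le _ _).trans (le_of_eq ?_)
    rw [abs_mul, abs_of_nonneg (gaussianFunction_pos S _).le, abs_div, abs_of_pos hS]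
  have hrhs : HasSum (fun j => ρ j * |1 / Z - 1 / S| + g j / S) (Z * |1 / Z - 1 / S| + A / S) :=
    (hρZ.mul_right _).add (hgsum.hasSum.div_const S)
  rw [PMF.tvDist]
  have hle := hasSum_le hpt (PMF.summable_abs_toReal_sub_toReal _ _).hasSum hrhs
  have h1 : Z * |1 / Z - 1 / S| = |S - Z| / S := by
    rw [show 1 / Z - 1 / S = (S - Z) / (Z * S) by field_simp, abs_div, abs_of_pos (mul_pos hZ0 hS)]
    field_simp
  rw [h1] at hle
  have h2 : |S - Z| / S ≤ A / S := div_le_div_of_nonneg_right hSZ hS.le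
  have h3 : A / S ≤ 2 / S := div_le_div_of_nonneg_right hA2 hS.le
  calc 2⁻¹ * ∑' j, |(discreteGaussianInt S 0 j).toReal - (floorGaussian L α₀ j).toReal|
      ≤ 2⁻¹ * (|S - Z| / S + A / S) := mul_le_mul_of_nonneg_left hle (by norm_num)
    _ ≤ 2 / S := by linarith

end Regev2009

end Literature.Computability.Cryptography

end
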